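import Summits.NavierStokesRegularity.NavierStokesRegularity.Theorems.PeepholeVorticityDoorCoreDefs

/-!
# PeepholeVorticityDoorBudget — door S29 «PeepholeVorticityDoor», FILE 2: Stub B3 `CarlemanBudgetS29` (the scalar Carleman budget: existential, scale-free; pure real analysis)

Plate of record: nsreg-p1 g23 `r27/BudgetB3.lean` sha16 aeb50670361461f4 (farm rc 0 · 0 sorry; refuter1 g9 K-65 PASS: statement IDENTICAL to
`r27/Skeleton29.lean` a83afe48495060f1), re-based by ns-s29-p2 g2 on `PeepholeVorticityDoorCoreDefs` (the §1 quantities and the stub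
text `CarlemanBudgetS29` are imported from there, local copies dropped; proof bodies untouched; DIRECTOR-NS #135 (b)).

(B3a) scale identity: at the slice `t̄ < 0`, with `ℓ = √(−t̄)`, the budget's left side equals `ℓ · Φ(r_T, S, ε)` and its right side
equals `ℓ · (τθ²/5)`; (B3b) `∃ r_T S ε, Φ ≤ τθ²/5` — choose `r_T` (the Gaussian factor `e^{−r_T²/(500τ)}` beats `r_T³`), then `S`
(the double-exponential tail `e^{−r_p² e^{S}/(4τ)}` beats `e^{(Kt r_T²/τ + 3/2)S}`), then `ε`.  No NS content.

Closes `theorem carlemanBudgetS29_holds : CarlemanBudgetS29` — one of the six hypotheses of `peepholeToCore_of_stubs`.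
WHAT THIS IS NOT: not NS regularity; not `NoTypeII` (stmt-0056 OPEN); analytic bookkeeping for a HYPOTHETICAL-blow-up door.
-/

noncomputable section

set_option linter.dupNamespace false

open MeasureTheory Set Filter Topology Metric
open scoped Topology

namespace Summit.NavierStokesRegularity.NavierStokesRegularity.Theorems.PeepholeVorticityDoor

/-- The `ℓ`-free budget `Φ(r_T, S, ε)` (both sides of the B3 inequality are `√(−t̄) ×` an `ℓ`-free quantity). -/
def budgetPhiS29 (Kt Tc τ K K₂ d R rp rT S ε : ℝ) : ℝ :=
  Tc * Real.exp ((d + 3 * R) ^ 2 / (4 * τ)) *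
    (Kt * (Real.exp (-rT ^ 2 / (500 * τ)) * (36 * vB * rT ^ 3 * (K ^ 2 + Tc * K₂ ^ 2)) +
      τ ^ ((3 : ℝ) / 2) * Real.exp (Kt * (rT ^ 2 / τ) * (1 + S)) *
        (ε ^ 2 * (4 * Real.pi) ^ ((3 : ℝ) / 2) +
          36 * K ^ 2 * vB * rT ^ 3 * ((τ ^ ((3 : ℝ) / 2))⁻¹ * Real.exp ((3 : ℝ) / 2 * S) * Real.exp (-(rp ^ 2 * Real.exp S / (4 * τ)))))))

/-! ## (B3a) the scale identity -/

/-- `(ℓ²)^{3/2} = ℓ³` for `ℓ ≥ 0`. -/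
theorem sq_rpow_three_halves {ℓ : ℝ} (hℓ : 0 ≤ ℓ) : (ℓ ^ 2) ^ ((3 : ℝ) / 2) = ℓ ^ 3 := by
  rw [show ℓ ^ 2 = ℓ ^ ((2 : ℕ) : ℝ) from (Real.rpow_natCast ℓ 2).symm, ← Real.rpow_mul hℓ,
    show ((2 : ℕ) : ℝ) * ((3 : ℝ) / 2) = ((3 : ℕ) : ℝ) by norm_num, Real.rpow_natCast]

/-- **(B3a)** the left side of the budget at the slice `t̄` equals `√(−t̄) · Φ`. -/
theorem budget_lhs_eq {Kt Tc τ K K₂ d R rp rT S ε tb : ℝ} (hTc : 0 < Tc) (hτ : 0 < τ) (htb : tb < 0) :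
    (Tc * (-tb)) * Real.exp ((d + 3 * R) ^ 2 / (4 * τ)) *
          (Kt * (Real.exp (-(rT * Real.sqrt (-tb)) ^ 2 / (500 * (τ * (-tb)))) * ((Tc * (-tb)) * (vB * (rT * Real.sqrt (-tb)) ^ 3) * ((Tc * (-tb))⁻¹ * (6 * K / (-tb)) ^ 2 + (6 * K₂ / ((-tb) * Real.sqrt (-tb))) ^ 2)) + (τ * (-tb)) ^ ((3 : ℝ) / 2) * Real.exp (Kt * ((rT * Real.sqrt (-tb)) ^ 2 / (τ * (-tb))) * Real.log (Real.exp 1 * (τ * (-tb)) / (τ * (-tb) * Real.exp (-S)))) * ((ε / (-tb)) ^ 2 * (4 * Real.pi) ^ ((3 : ℝ) / 2) + (6 * K / (-tb)) ^ 2 * (vB * (rT * Real.sqrt (-tb)) ^ 3) * ((τ * (-tb) * Real.exp (-S)) ^ (-(3 : ℝ) / 2) * Real.exp (-(rp * Real.sqrt (-tb)) ^ 2 / (4 * (τ * (-tb) * Real.exp (-S))))))))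
      = Real.sqrt (-tb) * budgetPhiS29 Kt Tc τ K K₂ d R rp rT S ε := by
  have hn : 0 < -tb := by linarith
  set ℓ := Real.sqrt (-tb) with hℓdef
  have hℓ : 0 < ℓ := Real.sqrt_pos.2 hn
  have hℓ2 : ℓ ^ 2 = -tb := Real.sq_sqrt hn.le
  rw [← hℓ2]
  have hℓne : ℓ ≠ 0 := hℓ.ne'
  have hτℓ : 0 < τ * ℓ ^ 2 := by positivity
  have hP : 0 < τ ^ ((3 : ℝ) / 2) := Real.rpow_pos_of_pos hτ _
  -- the six sub-identities
  have e1 : Real.exp (-(rT * ℓ) ^ 2 / (500 * (τ * ℓ ^ 2))) = Real.exp (-rT ^ 2 / (500 * τ)) := by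
    congr 1; field_simp
  have e2 : Real.log (Real.exp 1 * (τ * ℓ ^ 2) / (τ * ℓ ^ 2 * Real.exp (-S))) = 1 + S := by
    have : Real.exp 1 * (τ * ℓ ^ 2) / (τ * ℓ ^ 2 * Real.exp (-S)) = Real.exp (1 + S) := by
      rw [Real.exp_add, Real.exp_neg]; field_simp
    rw [this, Real.log_exp]
  have e3 : (τ * ℓ ^ 2) ^ ((3 : ℝ) / 2) = τ ^ ((3 : ℝ) / 2) * ℓ ^ 3 := by
    rw [Real.mul_rpow hτ.le (sq_nonneg ℓ), sq_rpow_three_halves hℓ.le]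
  have e4 : (τ * ℓ ^ 2 * Real.exp (-S)) ^ (-(3 : ℝ) / 2) =
      (τ ^ ((3 : ℝ) / 2))⁻¹ * (ℓ ^ 3)⁻¹ * Real.exp ((3 : ℝ) / 2 * S) := by
    rw [show (-(3 : ℝ) / 2) = -((3 : ℝ) / 2) by ring, Real.rpow_neg (by positivity),
      Real.mul_rpow hτℓ.le (Real.exp_pos _).le, e3, ← Real.exp_mul,
      show -S * ((3 : ℝ) / 2) = -((3 : ℝ) / 2 * S) by ring, Real.exp_neg]
    field_simp
  have e5 : Real.exp (-(rp * ℓ) ^ 2 / (4 * (τ * ℓ ^ 2 * Real.exp (-S)))) =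
      Real.exp (-(rp ^ 2 * Real.exp S / (4 * τ))) := by
    congr 1
    rw [Real.exp_neg]
    field_simp
  have e6 : Kt * ((rT * ℓ) ^ 2 / (τ * ℓ ^ 2)) * (1 + S) = Kt * (rT ^ 2 / τ) * (1 + S) := by
    field_simp
  rw [e1, e2, e6, e3, e4, e5]
  unfold budgetPhiS29
  field_simp
  ring

/-- **(B3a)** the right side of the budget at the slice `t̄` equals `√(−t̄) · τθ²/5`. -/
theorem budget_rhs_eq {τ θ tb : ℝ} (htb : tb < 0) :
    (τ * (-tb)) * (θ ^ 2 / (5 * Real.sqrt (-tb))) = Real.sqrt (-tb) * (τ * θ ^ 2 / 5) := by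
  have hn : 0 < -tb := by linarith
  set ℓ := Real.sqrt (-tb) with hℓdef
  have hℓ : 0 < ℓ := Real.sqrt_pos.2 hn
  have hℓ2 : ℓ ^ 2 = -tb := Real.sq_sqrt hn.le
  rw [← hℓ2]
  field_simp

/-! ## (B3b) the parameter choice -/

/-- `x ↦ C · x³ · e^{−x²/c}` is eventually small (`r_T` choice). -/
theorem eventually_term1_lt {C c δ : ℝ} (hC : 0 ≤ C) (hc : 0 < c) (hδ : 0 < δ) :
    ∀ᶠ x : ℝ in atTop, C * (Real.exp (-x ^ 2 / c) * x ^ 3) < δ := by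
  have h := (tendsto_rpow_mul_exp_neg_mul_atTop_nhds_zero 3 (1 / c) (by positivity)).const_mul C
  rw [mul_zero] at h
  filter_upwards [h.eventually (gt_mem_nhds hδ), eventually_ge_atTop (1 : ℝ)] with x hx hx1
  refine lt_of_le_of_lt ?_ hx
  have hx0 : 0 ≤ x := by linarith
  rw [show x ^ (3 : ℝ) = x ^ 3 by exact_mod_cast Real.rpow_natCast x 3]
  apply mul_le_mul_of_nonneg_left _ hC
  rw [mul_comm]
  apply mul_le_mul_of_nonneg_left _ (by positivity)
  apply Real.exp_le_exp.2
  have hxx : x ≤ x ^ 2 := by nlinarith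
  have : x / c ≤ x ^ 2 / c := by gcongr
  rw [neg_div, neg_mul, one_div, inv_mul_eq_div]
  linarith

/-- `S ↦ C · e^{a(1+S)} · e^{(3/2)S} · e^{−b e^{S}}` is eventually small (`S` choice, `y = e^S`). -/
theorem eventually_term2_lt {C a b δ : ℝ} (hb : 0 < b) (hδ : 0 < δ) :
    ∀ᶠ S : ℝ in atTop, C * (Real.exp (a * (1 + S)) * (Real.exp ((3 : ℝ) / 2 * S) * Real.exp (-(b * Real.exp S)))) < δ := by
  have h := ((tendsto_rpow_mul_exp_neg_mul_atTop_nhds_zero (a + 3 / 2) b hb).comp Real.tendsto_exp_atTop).const_mul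
    (C * Real.exp a)
  rw [mul_zero] at h
  filter_upwards [h.eventually (gt_mem_nhds hδ)] with S hS
  refine lt_of_le_of_lt (le_of_eq ?_) hS
  simp only [Function.comp]
  rw [← Real.exp_mul]
  have : Real.exp (a * (1 + S)) * (Real.exp ((3 : ℝ) / 2 * S) * Real.exp (-(b * Real.exp S))) =
      Real.exp a * (Real.exp (S * (a + 3 / 2)) * Real.exp (-b * Real.exp S)) := by
    rw [← Real.exp_add, ← Real.exp_add, ← Real.exp_add, ← Real.exp_add]
    congr 1; ring
  rw [this]; ring

/-- **(B3b)** the parameter choice: `∃ r_T S ε` admissible with `Φ(r_T, S, ε) ≤ τθ²/5` (three `Tendsto … (𝓝 0)` picks). -/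
theorem exists_budget_params {Kt Tc τ θ R K K₂ d rp : ℝ} (hKt : 0 < Kt) (hTc : 0 < Tc) (hτ : 0 < τ) (hθ : 0 < θ)
    (hR : 2 ≤ R) (hK : 0 < K) (hK₂ : 0 < K₂) (hd : 0 ≤ d) (hrp : 0 < rp) :
    ∃ rT S ε : ℝ, 2 * (d + 3 * R) + 2 ≤ rT ∧ 4000 * Tc ≤ rT ^ 2 ∧ 0 ≤ S ∧ 0 < ε ∧
      budgetPhiS29 Kt Tc τ K K₂ d R rp rT S ε ≤ τ * θ ^ 2 / 5 := by
  set δ : ℝ := τ * θ ^ 2 / 15 with hδdef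
  have hδ : 0 < δ := by positivity
  set C₀ : ℝ := Tc * Real.exp ((d + 3 * R) ^ 2 / (4 * τ)) * Kt with hC₀def
  have hC₀ : 0 < C₀ := by positivity
  have hvB : 0 ≤ vB := ENNReal.toReal_nonneg
  -- choice of rT
  obtain ⟨rT, hrT1, hrTlow⟩ := ((eventually_term1_lt (C := C₀ * (36 * vB * (K ^ 2 + Tc * K₂ ^ 2))) (c := 500 * τ)
    (by positivity) (by positivity) hδ).and (eventually_ge_atTop (max (2 * (d + 3 * R) + 2) (4000 * Tc)))).exists
  have hrTd : 2 * (d + 3 * R) + 2 ≤ rT := (le_max_left _ _).trans hrTlow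
  have hrT4 : 4000 * Tc ≤ rT := (le_max_right _ _).trans hrTlow
  have hrT1' : 1 ≤ rT := by linarith
  have hrT0 : 0 < rT := by linarith
  -- choice of S
  obtain ⟨S, hS2, hS0⟩ := ((eventually_term2_lt (C := C₀ * (36 * K ^ 2 * vB * rT ^ 3)) (a := Kt * (rT ^ 2 / τ))
    (b := rp ^ 2 / (4 * τ)) (by positivity) hδ).and (eventually_ge_atTop (0 : ℝ))).exists
  -- choice of ε
  set C₃ : ℝ := C₀ * τ ^ ((3 : ℝ) / 2) * Real.exp (Kt * (rT ^ 2 / τ) * (1 + S)) * (4 * Real.pi) ^ ((3 : ℝ) / 2)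
    with hC₃def
  have hP : 0 < τ ^ ((3 : ℝ) / 2) := Real.rpow_pos_of_pos hτ _
  have hC₃ : 0 < C₃ := by positivity
  set ε : ℝ := min 1 (δ / (C₃ + 1)) with hεdef
  have hε : 0 < ε := lt_min one_pos (by positivity)
  have hε1 : ε ≤ 1 := min_le_left _ _
  have hε2 : ε ≤ δ / (C₃ + 1) := min_le_right _ _
  have hterm3 : C₃ * ε ^ 2 ≤ δ := by
    have h1 : ε ^ 2 ≤ δ / (C₃ + 1) := by nlinarith
    calc C₃ * ε ^ 2 ≤ C₃ * (δ / (C₃ + 1)) := mul_le_mul_of_nonneg_left h1 hC₃.le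
      _ ≤ δ := by rw [mul_div_assoc', div_le_iff₀ (by positivity)]; nlinarith
  refine ⟨rT, S, ε, hrTd, by nlinarith, hS0, hε, ?_⟩
  -- split Φ into the three terms
  have hsplit : budgetPhiS29 Kt Tc τ K K₂ d R rp rT S ε =
      C₀ * (36 * vB * (K ^ 2 + Tc * K₂ ^ 2)) * (Real.exp (-rT ^ 2 / (500 * τ)) * rT ^ 3) +
      (C₃ * ε ^ 2 +
        C₀ * (36 * K ^ 2 * vB * rT ^ 3) * (Real.exp (Kt * (rT ^ 2 / τ) * (1 + S)) *
          (Real.exp ((3 : ℝ) / 2 * S) * Real.exp (-(rp ^ 2 / (4 * τ) * Real.exp S))))) := by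
    have hPne : τ ^ ((3 : ℝ) / 2) ≠ 0 := hP.ne'
    rw [show rp ^ 2 / (4 * τ) * Real.exp S = rp ^ 2 * Real.exp S / (4 * τ) by ring, hC₃def, hC₀def]
    unfold budgetPhiS29
    field_simp
  rw [hsplit]
  have h3δ : δ + (δ + δ) = τ * θ ^ 2 / 5 := by rw [hδdef]; ring
  rw [← h3δ]
  exact add_le_add hrT1.le (add_le_add hterm3 hS2.le)

/-! ## Stub B3 -/

/-- **Stub B3** `CarlemanBudgetS29` holds. -/
theorem carlemanBudgetS29_holds : CarlemanBudgetS29 := by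
  intro Kt hKt Tc τ θ R K K₂ d rp hTc hτ hθ hR hK hK₂ hd hrp
  obtain ⟨rT, S, ε, h1, h2, h3, h4, hΦ⟩ := exists_budget_params hKt hTc hτ hθ hR hK hK₂ hd hrp
  refine ⟨rT, S, ε, h1, h2, h3, h4, fun tb htb => ?_⟩
  rw [budget_lhs_eq hTc hτ htb, budget_rhs_eq htb]
  exact mul_le_mul_of_nonneg_left hΦ (Real.sqrt_nonneg _)

end Summit.NavierStokesRegularity.NavierStokesRegularity.Theorems.PeepholeVorticityDoor

end
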